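import Summits.QuantumFields.YangMills.Theorems.BalabanUVNodesN15CovariantLandauSopInvRowFromFlat
import HarnessLib

/-!
# Route «BalabanUVNodes», node N15 = NE2, road (c) — PROGRAMME (P-S), XLV: THE FOUR ONE-GRID `T`-ROWS OF n15-c∕243 — `G′(T)`, `∂G′(T)`, `D_TG′(T)`, `S(T)⁻¹` — FROM THE FOUR FLAT ROWS AND
# THE TRANSPORTER LETTERS ONLY (n15-c∕231's steps 1–3 by the Leibniz route + n15-c∕251), at the common rate `3δ/8` with the simple constants `2C_G`, `2(C_D + c_A·2C_G·c)`, `C_D + c_P·r`, `2C_S·n^{d+1}`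
# (dag-n15-c g25, n15-c∕252)

Cell `pub-ymgap`, seat `pub-ymgap-dag-n15-c` (generation g25; R134 (a), s1; HUMAN RULING D-0062; chair R424 venue).  `bears_on: R4∕N15 · K3⁸ SpineGivenEndpointR13SepCoPHV
(stmt-QuantumFields-27366)`; filed `--supports stmt-QuantumFields-27366 --as helper` — COUNT-NEUTRAL.  One theorem; 0 `sorry`.  Imports BY NAME n15-c∕228 (`hasMaj_cGreen_of_flat'`), 229
(`hasMaj_cgrad_one_cGreen_of_flat'`), 230 (`hasMaj_cgrad_cGreen_sub_of_flat'`), 231 (`cXL cYL cAL cPL`; its steps 1–3 verbatim), 251 (`hasMaj_cSop_inv_of_flat_gradDiff`).  Nothing in the tree is modified.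

WHY.  n15-c∕243 displays, per grid, the one-grid rows `hX, hY, hDT, hSi` of `G′(T)`, `∂G′(T)`, `D_TG′(T) = cgrad T·cGreen T`, `S(T)⁻¹`; n15-c∕231 derives the first three (and n15-c∕217∕251 the
fourth) from the four FLAT rows + the letters `ρ, λ, σ` (`nρ ≤ C_ρr`, `n²λ ≤ C_lr`, `σ ≤ C_σr`) below the smallness threshold — THIS FILE returns them, so that 243's `T`-rows become theorems of
(3.35) once the letters are discharged (n15-c∕218∕226∕232∕233a) and the flat rows are dag-n15-a's (Ξ-6).
* ★★★ **`tRows_of_flat''`** (hypotheses = n15-c∕231's, verbatim).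

HONEST FRAMING ∕ LIMITS.  Bookkeeping; the four flat rows are HYPOTHESES here; MODEL carriers; NOT [Balaban1985BackgroundPropagators] Thm 3.4 ∕ Lemma 3.3 as printed; NE2⁺ NOT PRINTED; N15 of record
untouched (DISCHARGED AS CONSUMED, p687738); counts UNMOVED (typed 28∕28 · discharged 8∕27); one finite 𝕋⁴ at fixed ε per index — NOT infinite volume ∕ OS ∕ mass gap ∕ Clay.  Restate-immune (no Theses import).
-/

noncomputable section

open scoped BigOperators Matrix
open Finset

namespace Summit.QuantumFields.YangMills.BalabanUVNodes.N15.CovLandau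

open Literature.MathematicalPhysics.QuantumFieldTheory.Balaban1983to89
open Literature.MathematicalPhysics.QuantumFieldTheory.Balaban1983to89.B5Prop11Plancherel (Tor fine unitVec)
open Literature.MathematicalPhysics.QuantumFieldTheory.Balaban1983to89.B11SectG (BlockNorm HasMaj RowSum)
open Literature.MathematicalPhysics.QuantumFieldTheory.Balaban1983to89.B6UnitTorusCarrier (unitTorusGeo rowSum_unitTorusGeo unitTorusGeo_dist_nonneg)
open Literature.MathematicalPhysics.QuantumFieldTheory.King1986.Torus (blockOf tdistT)
open Summit.QuantumFields.YangMills.BalabanUVNodes.N15.MatrixSpecies (liftBlk)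
open Summit.QuantumFields.YangMills.BalabanUVNodes.N15.CovAvg (cvaStair cvaStair_one rows_le_of_rows_sub_one cols_le_of_cols_sub_one)

variable {d : ℕ}

section Main

variable (M : Fin (d + 1) → ℕ) [∀ μ, NeZero (M μ)] (n : ℕ) [NeZero n] {ι : Type} [Fintype ι] [DecidableEq ι] (L k : ℕ)

set_option maxHeartbeats 1600000 in
/-- ★★★ **THE FOUR ONE-GRID `T`-ROWS OF n15-c∕243 FROM THE FOUR FLAT ROWS AND THE LETTERS** (common rate `3δ/8`): `G′(T) ≤ 2C_G`, `∂G′(T) ≤ 2(C_D + c_A·2C_G·c)`, `D_TG′(T) ≤ C_D + c_P·r`,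
`S(T)⁻¹ ≤ 2C_S·n^{d+1}`. [cite: Balaban1985BackgroundPropagators, (3.49) p.399, Thm 3.4 p.400, Lemma 3.3 p.402 (mechanism); Balaban1984PropagatorsII, Props. 2.2–2.3 pp.228–231 (shapes)] -/
theorem tRows_of_flat'' {T : Fin (d + 1) → Tor (fine n M) → Matrix ι ι ℝ} (hT : ∀ ν x, IsUnit (T ν x)) {a : ℝ} (ha : 0 < a)
    {δ CG CA CD CS Cρ Cl Cσ α r ρ lam σ : ℝ} (hδ : 0 < δ) (hCG : 0 ≤ CG) (hCA : 0 ≤ CA) (hCD : 0 ≤ CD) (hCS : 0 ≤ CS) (hCρ : 0 ≤ Cρ) (hCl : 0 ≤ Cl) (hCσ : 0 ≤ Cσ) (hα : 0 ≤ α)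
    (hr0 : 0 ≤ r) (hr1 : r ≤ 1) (hρ0 : 0 ≤ ρ) (hlam0 : 0 ≤ lam) (hσ0 : 0 ≤ σ) (haα : |a| * ((n : ℝ) ^ (d + 1))⁻¹ ≤ α)
    (hρr : ∀ ν x i, ∑ j, |(T ν x - (fun (_ : Fin (d + 1)) (_ : Tor (fine n M)) => (1 : Matrix ι ι ℝ)) ν x) i j| ≤ ρ)
    (hρc : ∀ ν x j, ∑ i, |(T ν x - (fun (_ : Fin (d + 1)) (_ : Tor (fine n M)) => (1 : Matrix ι ι ℝ)) ν x) i j| ≤ ρ)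
    (hlamr : ∀ μ (z : Tor (fine n M)) i, ∑ j, |(T μ z - T μ (z - unitVec (fine n M) μ)) i j| ≤ lam)
    (hlamc : ∀ μ (z : Tor (fine n M)) i, ∑ j, |(T μ z - T μ (z - unitVec (fine n M) μ)) j i| ≤ lam)
    (hσr : ∀ y a' i, ∑ j, |(cvaStair M n (fun μ b => T μ b.1) y a' 0 - cvaStair M n (fun μ b => (fun (_ : Fin (d + 1)) (_ : Tor (fine n M)) => (1 : Matrix ι ι ℝ)) μ b.1) y a' 0) i j| ≤ σ)
    (hσc : ∀ y a' j, ∑ i, |(cvaStair M n (fun μ b => T μ b.1) y a' 0 - cvaStair M n (fun μ b => (fun (_ : Fin (d + 1)) (_ : Tor (fine n M)) => (1 : Matrix ι ι ℝ)) μ b.1) y a' 0) i j| ≤ σ)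
    (hnρ : (n : ℝ) * ρ ≤ Cρ * r) (hnlam : (n : ℝ) * ((n : ℝ) * lam) ≤ Cl * r) (hσle : σ ≤ Cσ * r)
    (hG1 : HasMaj (BlockNorm.ofBlocks (unitTorusGeo L k M) (liftBlk (blockOf n M) ι)) (BlockNorm.ofBlocks (unitTorusGeo L k M) (liftBlk (blockOf n M) ι)) (Matrix.mulVecLin (cGreen M n (fun (_ : Fin (d + 1)) (_ : Tor (fine n M)) => (1 : Matrix ι ι ℝ)) a)) (fun y y' => CG * Real.exp (-(δ * tdistT M y y'))))
    (hA1 : HasMaj (BlockNorm.ofBlocks (unitTorusGeo L k M) (liftBlk (fun b : Tor (fine n M) × Fin (d + 1) => blockOf n M b.1) ι)) (BlockNorm.ofBlocks (unitTorusGeo L k M) (liftBlk (blockOf n M) ι)) (Matrix.mulVecLin ((cGreen M n (fun (_ : Fin (d + 1)) (_ : Tor (fine n M)) => (1 : Matrix ι ι ℝ)) a) * (cgrad M n (fun (_ : Fin (d + 1)) (_ : Tor (fine n M)) => (1 : Matrix ι ι ℝ)))ᵀ)) (fun y y' => CA * Real.exp (-(δ * tdistT M y y'))))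
    (hD1 : HasMaj (BlockNorm.ofBlocks (unitTorusGeo L k M) (liftBlk (blockOf n M) ι)) (BlockNorm.ofBlocks (unitTorusGeo L k M) (liftBlk (fun b : Tor (fine n M) × Fin (d + 1) => blockOf n M b.1) ι)) (Matrix.mulVecLin ((cgrad M n (fun (_ : Fin (d + 1)) (_ : Tor (fine n M)) => (1 : Matrix ι ι ℝ))) * (cGreen M n (fun (_ : Fin (d + 1)) (_ : Tor (fine n M)) => (1 : Matrix ι ι ℝ)) a))) (fun y y' => CD * Real.exp (-(δ * tdistT M y y'))))
    (hS1 : HasMaj (BlockNorm.ofBlocks (unitTorusGeo L k M) (liftBlk (fun y : Tor M => y) ι)) (BlockNorm.ofBlocks (unitTorusGeo L k M) (liftBlk (fun y : Tor M => y) ι)) (Matrix.mulVecLin (cSop M n (fun (_ : Fin (d + 1)) (_ : Tor (fine n M)) => (1 : Matrix ι ι ℝ)) a)⁻¹) (fun y y' => CS * (n : ℝ) ^ (d + 1) * Real.exp (-(δ * tdistT M y y'))))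
    (hsmallL : (2 * cXL ((d : ℝ) + 1) CG CA Cρ Cl Cσ α (B4Sect5Proof.latticeConst (d + 1) (δ / 8)) δ (δ / 8) * B4Sect5Proof.latticeConst (d + 1) (δ / 8)
        + 2 * cYL ((d : ℝ) + 1) CD Cρ (B4Sect5Proof.latticeConst (d + 1) (δ / 8)) δ * B4Sect5Proof.latticeConst (d + 1) (δ / 8) + Cσ) * r ≤ 1)
    (hsmall : landauSmallConst ((d : ℝ) + 1) (Fintype.card ι) CG CA CD CS (cPL ((d : ℝ) + 1) CG CD Cρ Cl Cσ α (B4Sect5Proof.latticeConst (d + 1) (δ / 8)) δ (δ / 8)) Cρ Cσ α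
        (B4Sect5Proof.latticeConst (d + 1) (δ / 2 / 16)) (δ / 2) * r ≤ 1) :
    HasMaj (BlockNorm.ofBlocks (unitTorusGeo L k M) (liftBlk (blockOf n M) ι)) (BlockNorm.ofBlocks (unitTorusGeo L k M) (liftBlk (blockOf n M) ι)) (Matrix.mulVecLin (cGreen M n T a)) (fun y y' => (2 * CG) * Real.exp (-((3 * δ / 8) * tdistT M y y'))) ∧
    HasMaj (BlockNorm.ofBlocks (unitTorusGeo L k M) (liftBlk (blockOf n M) ι)) (BlockNorm.ofBlocks (unitTorusGeo L k M) (liftBlk (fun b : Tor (fine n M) × Fin (d + 1) => blockOf n M b.1) ι)) (Matrix.mulVecLin ((cgrad M n (fun (_ : Fin (d + 1)) (_ : Tor (fine n M)) => (1 : Matrix ι ι ℝ))) * (cGreen M n T a))) (fun y y' => (2 * (CD + cAL ((d : ℝ) + 1) CD Cρ Cl Cσ α (B4Sect5Proof.latticeConst (d + 1) (δ / 8)) δ (δ / 8) * (2 * CG) * (B4Sect5Proof.latticeConst (d + 1) (δ / 8)))) * Real.exp (-((3 * δ / 8) * tdistT M y y'))) ∧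
    HasMaj (BlockNorm.ofBlocks (unitTorusGeo L k M) (liftBlk (blockOf n M) ι)) (BlockNorm.ofBlocks (unitTorusGeo L k M) (liftBlk (fun b : Tor (fine n M) × Fin (d + 1) => blockOf n M b.1) ι)) (Matrix.mulVecLin (cgrad M n T * (cGreen M n T a))) (fun y y' => (CD + cPL ((d : ℝ) + 1) CG CD Cρ Cl Cσ α (B4Sect5Proof.latticeConst (d + 1) (δ / 8)) δ (δ / 8) * r) * Real.exp (-((3 * δ / 8) * tdistT M y y'))) ∧
    HasMaj (BlockNorm.ofBlocks (unitTorusGeo L k M) (liftBlk (fun y : Tor M => y) ι)) (BlockNorm.ofBlocks (unitTorusGeo L k M) (liftBlk (fun y : Tor M => y) ι)) (Matrix.mulVecLin ((cSop M n T a))⁻¹) (fun y y' => ((n : ℝ) ^ (d + 1)) * (2 * CS) * Real.exp (-((3 * δ / 8) * tdistT M y y'))) := by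
  have hn : (0 : ℝ) < (n : ℝ) ^ (d + 1) := pow_pos (Nat.cast_pos.mpr (Nat.pos_of_ne_zero (NeZero.ne n))) _
  have hn1 : (0 : ℝ) ≤ (n : ℝ) := Nat.cast_nonneg n
  have hd := unitTorusGeo_dist_nonneg L k M
  set s : ℝ := δ / 8 with hsdef
  have hs : 0 < s := by positivity
  set c : ℝ := B4Sect5Proof.latticeConst (d + 1) s with hcdef
  have hrow : RowSum (unitTorusGeo L k M) s c := rowSum_unitTorusGeo L k M hs
  have hc : 0 ≤ c := B4Sect5Proof.latticeConst_nonneg (d + 1) hs.le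
  have hD : (0 : ℝ) ≤ ((d : ℝ) + 1) := by positivity
  obtain ⟨KX, hKXdef⟩ : ∃ x : ℝ, x = cXL ((d : ℝ) + 1) CG CA Cρ Cl Cσ α c δ s := ⟨_, rfl⟩
  have hKX : 0 ≤ KX := by rw [hKXdef]; unfold cXL; positivity
  obtain ⟨KY, hKYdef⟩ : ∃ x : ℝ, x = cYL ((d : ℝ) + 1) CD Cρ c δ := ⟨_, rfl⟩
  have hKY : 0 ≤ KY := by rw [hKYdef]; unfold cYL; positivity
  obtain ⟨KA, hKAdef⟩ : ∃ x : ℝ, x = cAL ((d : ℝ) + 1) CD Cρ Cl Cσ α c δ s := ⟨_, rfl⟩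
  have hKA : 0 ≤ KA := by rw [hKAdef]; unfold cAL; positivity
  obtain ⟨KP, hKPdef⟩ : ∃ x : ℝ, x = cPL ((d : ℝ) + 1) CG CD Cρ Cl Cσ α c δ s := ⟨_, rfl⟩
  have hKPeq : KP = KA * (2 * CG) * c + KY * (2 * (CD + KA * (2 * CG) * c)) * c + Cρ * Real.exp (δ + s) * (2 * CG) * c := by rw [hKPdef, hKAdef, hKYdef]; rfl
  have hKP : 0 ≤ KP := by rw [hKPeq]; positivity
  -- smallness consequences
  have hsm' : (2 * KX * c + 2 * KY * c + Cσ) * r ≤ 1 := by rw [hKXdef, hKYdef]; exact hsmallL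
  have hXc0 : 0 ≤ 2 * KX * c := by positivity
  have hYc0 : 0 ≤ 2 * KY * c := by positivity
  have hq1 : KX * c * r ≤ 1 / 2 := by nlinarith only [hsm', hXc0, hYc0, hCσ, hr0]
  have hq2 : KY * c * r ≤ 1 / 2 := by nlinarith only [hsm', hXc0, hYc0, hCσ, hr0]
  have hσ1 : σ ≤ 1 := hσle.trans (by nlinarith only [hsm', hXc0, hYc0, hCσ, hr0])
  -- letters: `τ = 1 + σ ≤ 2`, the `r`-scalings of the composite letters
  have e1 : ∀ (y : Tor M) (a' : Fin (d + 1) → Fin n), cvaStair M n (fun μ (b : Tor (fine n M) × Fin (d + 1)) => (fun (_ : Fin (d + 1)) (_ : Tor (fine n M)) => (1 : Matrix ι ι ℝ)) μ b.1) y a' 0 = 1 := fun y a' => cvaStair_one M n y a' 0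
  have hτr : ∀ y a' i, ∑ j, |cvaStair M n (fun μ b => T μ b.1) y a' 0 i j| ≤ 1 + σ := fun y a' i =>
    rows_le_of_rows_sub_one (A := cvaStair M n (fun μ b => T μ b.1) y a' 0) (fun i' => by have h := hσr y a' i'; rwa [e1] at h) i
  have hτ0 : (0 : ℝ) ≤ 1 + σ := by positivity
  have hτ2 : 1 + σ ≤ 2 := by linarith only [hσ1]
  have hDρ : (n : ℝ) * (((d + 1 : ℕ) : ℝ) * ρ) ≤ ((d : ℝ) + 1) * (Cρ * r) := by
    calc (n : ℝ) * (((d + 1 : ℕ) : ℝ) * ρ) = ((d : ℝ) + 1) * ((n : ℝ) * ρ) := by push_cast; ring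
      _ ≤ ((d : ℝ) + 1) * (Cρ * r) := mul_le_mul_of_nonneg_left hnρ hD
  have hCρr : Cρ * r ≤ Cρ := mul_le_of_le_one_right hCρ hr1
  have hee : ((n : ℝ) * (((d + 1 : ℕ) : ℝ) * ρ) * Real.exp (δ + s)) * ((n : ℝ) * ρ * Real.exp (δ + s)) * c ≤ ((((d : ℝ) + 1) * Cρ * Real.exp (δ + s)) * (Cρ * Real.exp (δ + s)) * c) * r := by
    have t1 : (n : ℝ) * (((d + 1 : ℕ) : ℝ) * ρ) * Real.exp (δ + s) ≤ ((d : ℝ) + 1) * Cρ * Real.exp (δ + s) :=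
      mul_le_mul_of_nonneg_right (hDρ.trans (by nlinarith only [hCρr, hD])) (Real.exp_pos _).le
    have t2 : (n : ℝ) * ρ * Real.exp (δ + s) ≤ Cρ * r * Real.exp (δ + s) := mul_le_mul_of_nonneg_right hnρ (Real.exp_pos _).le
    calc _ ≤ (((d : ℝ) + 1) * Cρ * Real.exp (δ + s)) * (Cρ * r * Real.exp (δ + s)) * c := by gcongr
      _ = _ := by ring
  have hστ : ((n : ℝ) ^ (d + 1))⁻¹ * CG * (σ * (1 + σ) + σ) ≤ ((n : ℝ) ^ (d + 1))⁻¹ * (CG * (3 * (Cσ * r))) := by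
    have h3 : σ * (1 + σ) + σ ≤ 3 * (Cσ * r) := by
      have : σ * (1 + σ) ≤ σ * 2 := mul_le_mul_of_nonneg_left hτ2 hσ0
      linarith only [this, hσle]
    calc _ = ((n : ℝ) ^ (d + 1))⁻¹ * (CG * (σ * (1 + σ) + σ)) := by ring
      _ ≤ _ := mul_le_mul_of_nonneg_left (mul_le_mul_of_nonneg_left h3 hCG) (inv_nonneg.mpr hn.le)
  -- STEP 1 (228): the row of `G′(T)`
  have hθK : CA * ((n : ℝ) * ρ * Real.exp δ) * c + CG * (((d : ℝ) + 1) * (n : ℝ) * ((n : ℝ) * lam)) + CA * ((n : ℝ) * ρ)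
      + CG * (((n : ℝ) * ((d + 1 : ℕ) * ρ) * Real.exp (δ + s)) * ((n : ℝ) * ρ * Real.exp (δ + s)) * c) * c + |a| * (((n : ℝ) ^ (d + 1))⁻¹ * CG * (σ * (1 + σ) + σ)) ≤ KX * r := by
    have h1 : CA * ((n : ℝ) * ρ * Real.exp δ) * c ≤ CA * (Cρ * r * Real.exp δ) * c := by gcongr
    have h2 : CG * (((d : ℝ) + 1) * (n : ℝ) * ((n : ℝ) * lam)) ≤ CG * (((d : ℝ) + 1) * (Cl * r)) := by
      rw [mul_assoc ((d : ℝ) + 1)]; exact mul_le_mul_of_nonneg_left (mul_le_mul_of_nonneg_left hnlam hD) hCG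
    have h3 : CA * ((n : ℝ) * ρ) ≤ CA * (Cρ * r) := mul_le_mul_of_nonneg_left hnρ hCA
    have h4 : CG * (((n : ℝ) * ((d + 1 : ℕ) * ρ) * Real.exp (δ + s)) * ((n : ℝ) * ρ * Real.exp (δ + s)) * c) * c ≤ CG * (((((d : ℝ) + 1) * Cρ * Real.exp (δ + s)) * (Cρ * Real.exp (δ + s)) * c) * r) * c :=
      mul_le_mul_of_nonneg_right (mul_le_mul_of_nonneg_left hee hCG) hc
    have h5 : |a| * (((n : ℝ) ^ (d + 1))⁻¹ * CG * (σ * (1 + σ) + σ)) ≤ α * (CG * (3 * (Cσ * r))) := by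
      calc |a| * (((n : ℝ) ^ (d + 1))⁻¹ * CG * (σ * (1 + σ) + σ)) ≤ |a| * (((n : ℝ) ^ (d + 1))⁻¹ * (CG * (3 * (Cσ * r)))) := mul_le_mul_of_nonneg_left hστ (abs_nonneg a)
        _ = (|a| * ((n : ℝ) ^ (d + 1))⁻¹) * (CG * (3 * (Cσ * r))) := by ring
        _ ≤ α * (CG * (3 * (Cσ * r))) := mul_le_mul_of_nonneg_right haα (by positivity)
    calc _ ≤ CA * (Cρ * r * Real.exp δ) * c + CG * (((d : ℝ) + 1) * (Cl * r)) + CA * (Cρ * r) + CG * (((((d : ℝ) + 1) * Cρ * Real.exp (δ + s)) * (Cρ * Real.exp (δ + s)) * c) * r) * c + α * (CG * (3 * (Cσ * r))) := by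
          linarith only [h1, h2, h3, h4, h5]
      _ = KX * r := by rw [hKXdef]; unfold cXL; ring
  have hθKc : (CA * ((n : ℝ) * ρ * Real.exp δ) * c + CG * (((d : ℝ) + 1) * (n : ℝ) * ((n : ℝ) * lam)) + CA * ((n : ℝ) * ρ)
      + CG * (((n : ℝ) * ((d + 1 : ℕ) * ρ) * Real.exp (δ + s)) * ((n : ℝ) * ρ * Real.exp (δ + s)) * c) * c + |a| * (((n : ℝ) ^ (d + 1))⁻¹ * CG * (σ * (1 + σ) + σ))) * c ≤ 1 / 2 :=
    (mul_le_mul_of_nonneg_right hθK hc).trans (by linarith only [hq1, show KX * r * c = KX * c * r by ring])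
  have hX0 := hasMaj_cGreen_of_flat' M n L k hT ha hs (by linarith) hrow hc hCG hCA hρ0 hlam0 hσ0 hτ0 hρr hρc hlamc hσr hσc hτr hG1 hA1 (by linarith only [hθKc])
  have hX : HasMaj (BlockNorm.ofBlocks (unitTorusGeo L k M) (liftBlk (blockOf n M) ι)) (BlockNorm.ofBlocks (unitTorusGeo L k M) (liftBlk (blockOf n M) ι)) (Matrix.mulVecLin (cGreen M n T a)) (fun y y' => (2 * CG) * Real.exp (-((δ - 2 * s) * tdistT M y y'))) := by
    refine hX0.mono fun y y' => mul_le_mul_of_nonneg_right ?_ (Real.exp_nonneg _)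
    have hinv : (1 - (CA * ((n : ℝ) * ρ * Real.exp δ) * c + CG * (((d : ℝ) + 1) * (n : ℝ) * ((n : ℝ) * lam)) + CA * ((n : ℝ) * ρ)
        + CG * (((n : ℝ) * ((d + 1 : ℕ) * ρ) * Real.exp (δ + s)) * ((n : ℝ) * ρ * Real.exp (δ + s)) * c) * c + |a| * (((n : ℝ) ^ (d + 1))⁻¹ * CG * (σ * (1 + σ) + σ))) * c)⁻¹ ≤ 2 := by
      calc _ ≤ (1 / 2 : ℝ)⁻¹ := inv_anti₀ (by norm_num) (by linarith only [hθKc])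
        _ = 2 := by norm_num
    calc _ ≤ CG * 2 := mul_le_mul_of_nonneg_left hinv hCG
      _ = 2 * CG := mul_comm _ _
  -- STEP 2 (229): the row of `∂G′(T)`
  have hθ2 : CD * ((n : ℝ) * ((d + 1 : ℕ) * ρ) * Real.exp δ) * c + CD * (((d : ℝ) + 1) * ((n : ℝ) * ρ)) ≤ KY * r := by
    have h1 : CD * ((n : ℝ) * ((d + 1 : ℕ) * ρ) * Real.exp δ) * c ≤ CD * ((((d : ℝ) + 1) * (Cρ * r)) * Real.exp δ) * c := by gcongr
    have h2 : CD * (((d : ℝ) + 1) * ((n : ℝ) * ρ)) ≤ CD * (((d : ℝ) + 1) * (Cρ * r)) := by gcongr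
    calc _ ≤ CD * ((((d : ℝ) + 1) * (Cρ * r)) * Real.exp δ) * c + CD * (((d : ℝ) + 1) * (Cρ * r)) := add_le_add h1 h2
      _ = KY * r := by rw [hKYdef]; unfold cYL; ring
  have hθ2c : (CD * ((n : ℝ) * ((d + 1 : ℕ) * ρ) * Real.exp δ) * c + CD * (((d : ℝ) + 1) * ((n : ℝ) * ρ))) * c ≤ 1 / 2 :=
    (mul_le_mul_of_nonneg_right hθ2 hc).trans (by linarith only [hq2, show KY * r * c = KY * c * r by ring])
  have hY0 := hasMaj_cgrad_one_cGreen_of_flat' M n L k hT ha hs (by linarith) hrow hc hCD (by positivity : 0 ≤ 2 * CG) hρ0 hlam0 hσ0 hτ0 hρr hρc hlamr hσr hσc hτr hD1 hX (by linarith only [hθ2c])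
  -- the bracket `A₂ − C_D ≤ c_A·r·X·c` (with `X = 2C_G`)
  have hbr : CD * (((d : ℝ) + 1) * (n : ℝ) * ((n : ℝ) * lam)) * (2 * CG) * c + CD * (((n : ℝ) * ((d + 1 : ℕ) * ρ) * Real.exp (δ + s)) * ((n : ℝ) * ρ * Real.exp (δ + s)) * c) * c * (2 * CG) * c
      + |a| * (CD * (((n : ℝ) ^ (d + 1))⁻¹ * σ * (1 + σ))) * (2 * CG) * c + |a| * (CD * (((n : ℝ) ^ (d + 1))⁻¹ * 1 * σ)) * (2 * CG) * c ≤ KA * r * (2 * CG) * c := by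
    have h1 : CD * (((d : ℝ) + 1) * (n : ℝ) * ((n : ℝ) * lam)) ≤ CD * (((d : ℝ) + 1) * (Cl * r)) := by
      rw [mul_assoc ((d : ℝ) + 1)]; exact mul_le_mul_of_nonneg_left (mul_le_mul_of_nonneg_left hnlam hD) hCD
    have h2 : CD * (((n : ℝ) * ((d + 1 : ℕ) * ρ) * Real.exp (δ + s)) * ((n : ℝ) * ρ * Real.exp (δ + s)) * c) * c ≤ CD * (((((d : ℝ) + 1) * Cρ * Real.exp (δ + s)) * (Cρ * Real.exp (δ + s)) * c) * r) * c :=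
      mul_le_mul_of_nonneg_right (mul_le_mul_of_nonneg_left hee hCD) hc
    have h3 : |a| * (CD * (((n : ℝ) ^ (d + 1))⁻¹ * σ * (1 + σ))) ≤ α * (CD * (2 * (Cσ * r))) := by
      have t : σ * (1 + σ) ≤ 2 * (Cσ * r) := by nlinarith only [hτ2, hσ0, hσle]
      calc |a| * (CD * (((n : ℝ) ^ (d + 1))⁻¹ * σ * (1 + σ))) = (|a| * ((n : ℝ) ^ (d + 1))⁻¹) * (CD * (σ * (1 + σ))) := by ring
        _ ≤ α * (CD * (2 * (Cσ * r))) := mul_le_mul haα (mul_le_mul_of_nonneg_left t hCD) (by positivity) hα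
    have h4 : |a| * (CD * (((n : ℝ) ^ (d + 1))⁻¹ * 1 * σ)) ≤ α * (CD * (Cσ * r)) := by
      calc |a| * (CD * (((n : ℝ) ^ (d + 1))⁻¹ * 1 * σ)) = (|a| * ((n : ℝ) ^ (d + 1))⁻¹) * (CD * σ) := by ring
        _ ≤ α * (CD * (Cσ * r)) := mul_le_mul haα (mul_le_mul_of_nonneg_left hσle hCD) (by positivity) hα
    have hG2 : 0 ≤ (2 * CG) * c := by positivity
    have s1 := mul_le_mul_of_nonneg_right h1 hG2
    have s2 := mul_le_mul_of_nonneg_right h2 hG2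
    have s3 := mul_le_mul_of_nonneg_right h3 hG2
    have s4 := mul_le_mul_of_nonneg_right h4 hG2
    calc _ = CD * (((d : ℝ) + 1) * (n : ℝ) * ((n : ℝ) * lam)) * ((2 * CG) * c) + CD * (((n : ℝ) * ((d + 1 : ℕ) * ρ) * Real.exp (δ + s)) * ((n : ℝ) * ρ * Real.exp (δ + s)) * c) * c * ((2 * CG) * c)
          + |a| * (CD * (((n : ℝ) ^ (d + 1))⁻¹ * σ * (1 + σ))) * ((2 * CG) * c) + |a| * (CD * (((n : ℝ) ^ (d + 1))⁻¹ * 1 * σ)) * ((2 * CG) * c) := by ring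
      _ ≤ CD * (((d : ℝ) + 1) * (Cl * r)) * ((2 * CG) * c) + CD * (((((d : ℝ) + 1) * Cρ * Real.exp (δ + s)) * (Cρ * Real.exp (δ + s)) * c) * r) * c * ((2 * CG) * c)
          + α * (CD * (2 * (Cσ * r))) * ((2 * CG) * c) + α * (CD * (Cσ * r)) * ((2 * CG) * c) := by linarith only [s1, s2, s3, s4]
      _ = KA * r * (2 * CG) * c := by rw [hKAdef]; unfold cAL; ring
  have hY : HasMaj (BlockNorm.ofBlocks (unitTorusGeo L k M) (liftBlk (blockOf n M) ι)) (BlockNorm.ofBlocks (unitTorusGeo L k M) (liftBlk (fun b : Tor (fine n M) × Fin (d + 1) => blockOf n M b.1) ι)) (Matrix.mulVecLin ((cgrad M n (fun (_ : Fin (d + 1)) (_ : Tor (fine n M)) => (1 : Matrix ι ι ℝ))) * (cGreen M n T a))) (fun y y' => (2 * (CD + KA * (2 * CG) * c)) * Real.exp (-((δ - 3 * s) * tdistT M y y'))) := by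
    refine hY0.mono fun y y' => mul_le_mul_of_nonneg_right ?_ (Real.exp_nonneg _)
    have hinv : (1 - (CD * ((n : ℝ) * ((d + 1 : ℕ) * ρ) * Real.exp δ) * c + CD * (((d : ℝ) + 1) * ((n : ℝ) * ρ))) * c)⁻¹ ≤ 2 := by
      calc _ ≤ (1 / 2 : ℝ)⁻¹ := inv_anti₀ (by norm_num) (by linarith only [hθ2c])
        _ = 2 := by norm_num
    have hA2 : CD + CD * (((d : ℝ) + 1) * (n : ℝ) * ((n : ℝ) * lam)) * (2 * CG) * c + CD * (((n : ℝ) * ((d + 1 : ℕ) * ρ) * Real.exp (δ + s)) * ((n : ℝ) * ρ * Real.exp (δ + s)) * c) * c * (2 * CG) * c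
        + |a| * (CD * (((n : ℝ) ^ (d + 1))⁻¹ * σ * (1 + σ))) * (2 * CG) * c + |a| * (CD * (((n : ℝ) ^ (d + 1))⁻¹ * 1 * σ)) * (2 * CG) * c ≤ CD + KA * (2 * CG) * c := by
      have : KA * r * (2 * CG) * c ≤ KA * (2 * CG) * c := by
        have := mul_le_of_le_one_right hKA hr1
        nlinarith only [this, hCG, hc, mul_nonneg hCG hc]
      linarith only [hbr, this]
    have hA20 : 0 ≤ CD + CD * (((d : ℝ) + 1) * (n : ℝ) * ((n : ℝ) * lam)) * (2 * CG) * c + CD * (((n : ℝ) * ((d + 1 : ℕ) * ρ) * Real.exp (δ + s)) * ((n : ℝ) * ρ * Real.exp (δ + s)) * c) * c * (2 * CG) * c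
        + |a| * (CD * (((n : ℝ) ^ (d + 1))⁻¹ * σ * (1 + σ))) * (2 * CG) * c + |a| * (CD * (((n : ℝ) ^ (d + 1))⁻¹ * 1 * σ)) * (2 * CG) * c := by positivity
    calc _ ≤ (CD + KA * (2 * CG) * c) * 2 := mul_le_mul hA2 hinv (inv_nonneg.mpr (by linarith only [hθ2c])) (by positivity)
      _ = 2 * (CD + KA * (2 * CG) * c) := mul_comm _ _
  -- STEP 3 (230): the covariant gradient-difference row, constant `≤ c_P·r`
  have hP0 := hasMaj_cgrad_cGreen_sub_of_flat' M n L k hT ha hs (by linarith) hrow hc hCD (by positivity : 0 ≤ 2 * CG) (by positivity : 0 ≤ 2 * (CD + KA * (2 * CG) * c)) hρ0 hlam0 hσ0 hτ0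
    hρr hρc hlamr hσr hσc hτr hD1 hX hY
  have hP : (CD * (((d : ℝ) + 1) * (n : ℝ) * ((n : ℝ) * lam)) * (2 * CG) * c + CD * (((n : ℝ) * ((d + 1 : ℕ) * ρ) * Real.exp (δ + s)) * ((n : ℝ) * ρ * Real.exp (δ + s)) * c) * c * (2 * CG) * c
          + |a| * (CD * (((n : ℝ) ^ (d + 1))⁻¹ * σ * (1 + σ))) * (2 * CG) * c + |a| * (CD * (((n : ℝ) ^ (d + 1))⁻¹ * 1 * σ)) * (2 * CG) * c)
          + (CD * ((n : ℝ) * ((d + 1 : ℕ) * ρ) * Real.exp δ) * c + CD * (((d : ℝ) + 1) * ((n : ℝ) * ρ))) * (2 * (CD + KA * (2 * CG) * c)) * c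
          + ((n : ℝ) * ρ * Real.exp (δ + s)) * (2 * CG) * c ≤ KP * r := by
    have t2 : (CD * ((n : ℝ) * ((d + 1 : ℕ) * ρ) * Real.exp δ) * c + CD * (((d : ℝ) + 1) * ((n : ℝ) * ρ))) * (2 * (CD + KA * (2 * CG) * c)) * c ≤ KY * r * (2 * (CD + KA * (2 * CG) * c)) * c :=
      mul_le_mul_of_nonneg_right (mul_le_mul_of_nonneg_right hθ2 (by positivity)) hc
    have t3 : ((n : ℝ) * ρ * Real.exp (δ + s)) * (2 * CG) * c ≤ (Cρ * r * Real.exp (δ + s)) * (2 * CG) * c := by gcongr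
    calc _ ≤ KA * r * (2 * CG) * c + KY * r * (2 * (CD + KA * (2 * CG) * c)) * c + (Cρ * r * Real.exp (δ + s)) * (2 * CG) * c := by linarith only [hbr, t2, t3]
      _ = KP * r := by rw [hKPeq]; ring
  have hδD : HasMaj (BlockNorm.ofBlocks (unitTorusGeo L k M) (liftBlk (blockOf n M) ι)) (BlockNorm.ofBlocks (unitTorusGeo L k M) (liftBlk (fun b : Tor (fine n M) × Fin (d + 1) => blockOf n M b.1) ι)) (Matrix.mulVecLin (cgrad M n T * (cGreen M n T a) - (cgrad M n (fun (_ : Fin (d + 1)) (_ : Tor (fine n M)) => (1 : Matrix ι ι ℝ))) * (cGreen M n (fun (_ : Fin (d + 1)) (_ : Tor (fine n M)) => (1 : Matrix ι ι ℝ)) a))) (fun y y' => KP * r * Real.exp (-((δ / 2) * tdistT M y y'))) := by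
    have e : δ - 4 * s = δ / 2 := by rw [hsdef]; ring
    rw [← e]
    exact hP0.mono fun y y' => mul_le_mul_of_nonneg_right hP (Real.exp_nonneg _)
  -- STEP 4: `S(T)⁻¹` by n15-c∕251 at the base rate `δ/2`; all four rows at the common rate `3δ/8`
  have hδ2 : 0 < δ / 2 := by positivity
  have hle : δ / 2 ≤ δ := by linarith
  have hSi := hasMaj_cSop_inv_of_flat_gradDiff M n L k hT ha hδ2 hCG hCA hCD hCS hKP hCρ hCσ hα hr0 hr1 hρ0 hσ0 haα hρr hρc hσr hσc hnρ hσle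
    (hG1.of_rate_le hd hCG hle) (hA1.of_rate_le hd hCA hle) (hD1.of_rate_le hd hCD hle) (hS1.of_rate_le hd (by positivity) hle) hδD (by rw [← hKPdef] at hsmall; exact hsmall)
  have hr1' : 3 * δ / 8 ≤ δ - 2 * s := by rw [hsdef]; linarith
  have hr2' : 3 * δ / 8 ≤ δ - 3 * s := by rw [hsdef]; linarith
  have hr3' : 3 * δ / 8 ≤ δ / 2 := by linarith
  have hr4' : 3 * δ / 8 ≤ δ := by linarith
  have hr5' : 3 * δ / 8 ≤ 3 * (δ / 2) / 4 := by linarith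
  have hKPr : 0 ≤ KP * r := mul_nonneg hKP hr0
  refine ⟨hX.of_rate_le hd (by positivity) hr1', ?_, ?_, ?_⟩
  · rw [← hKAdef]; exact hY.of_rate_le hd (by positivity) hr2'
  · have hsum := (hδD.of_rate_le hd hKPr hr3').add (hD1.of_rate_le hd hCD hr4')
    rw [← Matrix.mulVecLin_add, sub_add_cancel] at hsum
    rw [← hKPdef]
    exact hsum.mono fun y y' => le_of_eq (by ring)
  · exact (hSi.of_rate_le hd (by positivity) hr5').mono fun y y' => le_of_eq (by ring)

end Main

end Summit.QuantumFields.YangMills.BalabanUVNodes.N15.CovLandau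

end
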